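import Summits.QuantumFields.YangMills.Theorems.SqueezedSkewnessFinTorusTimeShift
import Summits.QuantumFields.YangMills.Theorems.ThermalDescentOddTorusRPSupport
import HarnessLib

/-!
# Test functions of bounded height on the hypercube `(2L+1)⁴`: windows, time translates, the positive half
# (helpers for stub A `stub_qrpTranslateLogConvex` of LINE χ₄ «RP chessboard escalator», node stmt-QuantumFields-23719)

For test functions supported in heights `(0, H]` with `2H + 3s ≤ s(2L+1)` (the admissibility of the route items `TorusKL`,
`ChordEscalator`, stub A), sampled at the centred lattice points `s·(cc t, cc x⃗)` of the hypercube `(2L+1)⁴`: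
* `int_window'`, `cc_eq_val_of_one_le` — a non-zero sample has lattice time `1 ≤ t ≤ L − 1` and centred coordinate `cc t = t`;
* `sample_translate` — if `gp = g(· + sN e₀)` and both are admissible, the sample of `gp` at time `t` is the sample of `g` at
  time `t + N` (addition in `Fin (2L+1)`): no centred-coordinate wrap occurs where either function is non-zero;
* `plaquette_congr_posHalf`, `dependsOn_smeared` — the smeared plaquette field `B(f) = Σₓ f(s·x) Σ_{μ<ν} Re tr U_{□(x,μ,ν)}` of an
  admissible `f` depends only on the positive half (spatial links at times `≤ L`, temporal links at times `≤ L − 1`), the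
  positivity class of `ThermalDescentOddTorusRP.stub_finTorusRP`;
* `smeared_translate` — `B(gp) = B(g) ∘ τ_{−N}` for the time shift `τ` of `SqueezedSkewnessFinTorusTimeShift.lean`.
Bookkeeping only; no route item, NT statement, rung or mass-gap statement is proved here.  Width seat `ym-line-sfw-p2-w4` g19
(cell `ym-idea-1`, free hands), `--supports stmt-QuantumFields-23719`. [folklore]
-/

set_option autoImplicit false

noncomputable section

open MeasureTheory Literature.MathematicalPhysics.QuantumFieldTheory
open Summit.QuantumFields.YangMills.Theorems.ThermalDescentReflection

namespace Summit.QuantumFields.YangMills.Theorems.QrpTranslateLogConvex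

/-! ## §4 Test functions of bounded height on the hypercube `(2L+1)⁴`: windows, translates, the positive half -/

section Window

open Literature.MathematicalPhysics.QuantumLattice

/-- Integer bounds from the height window: `0 < s·m ≤ H` with `2H + 3s ≤ s(2L+1)` forces `1 ≤ m ≤ L − 1`. [folklore] -/
theorem int_window' {L : ℕ} {s H : ℝ} (hs : 0 < s) (hH : 2 * H + 3 * s ≤ s * ((2 * L + 1 : ℕ) : ℝ)) (m : ℤ)
    (h1 : 0 < s * (m : ℝ)) (h2 : s * (m : ℝ) ≤ H) : 1 ≤ m ∧ m + 1 ≤ (L : ℤ) := by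
  have hm0 : (0 : ℝ) < m := pos_of_mul_pos_right h1 hs.le
  have hHL : H ≤ s * ((L : ℝ) - 1) := by push_cast at hH; nlinarith
  have hmL : (m : ℝ) ≤ (L : ℝ) - 1 := le_of_mul_le_mul_left (h2.trans hHL) hs
  constructor
  · exact_mod_cast (show (0 : ℝ) < m from hm0)
  · have : (m : ℝ) + 1 ≤ (L : ℤ) := by push_cast; linarith
    exact_mod_cast this

/-- The centred time coordinate of the hypercube is the `Fin`-value on the lower half: if the centred coordinate is `≥ 1`
then it equals `t.val`. [folklore] -/
theorem cc_eq_val_of_one_le {L : ℕ} (t : Fin (2 * L + 1))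
    (h : 1 ≤ (if 2 * t.val < 2 * L + 1 then (t.val : ℤ) else (t.val : ℤ) - (2 * L + 1 : ℕ))) :
    (if 2 * t.val < 2 * L + 1 then (t.val : ℤ) else (t.val : ℤ) - (2 * L + 1 : ℕ)) = t.val ∧ 2 * t.val < 2 * L + 1 := by
  have ht := t.isLt
  split_ifs at h ⊢ with h2
  · exact ⟨rfl, h2⟩
  · push_cast at h; omega

/-- **Samples of a time translate.**  If `gp = g(· + sN e₀)` and both `g` and `gp` are supported in heights `(0, H]` with
`2H + 3s ≤ s(2L+1)`, then the sample of `gp` at the lattice point with centred time coordinate `cc t` is the sample of `g` at the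
point with time `cc (t + N)`: no centred-coordinate wrap occurs where either function is non-zero. [folklore] -/
theorem sample_translate {L : ℕ} {s H : ℝ} (hs : 0 < s) (hH : 2 * H + 3 * s ≤ s * ((2 * L + 1 : ℕ) : ℝ))
    {g gp : EuclideanSpace ℝ (Fin 4) → ℝ} {N : ℕ}
    (hg : tsupport g ⊆ {y : EuclideanSpace ℝ (Fin 4) | 0 < y 0 ∧ y 0 ≤ H})
    (hgp : tsupport gp ⊆ {y : EuclideanSpace ℝ (Fin 4) | 0 < y 0 ∧ y 0 ≤ H})
    (hdef : ∀ y, gp y = g (y + (s * (N : ℝ)) • EuclideanSpace.single (0 : Fin 4) (1 : ℝ)))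
    (t : Fin (2 * L + 1)) (a b d : ℤ) :
    gp (s • siteToE (d := 4) ![(if 2 * t.val < 2 * L + 1 then (t.val : ℤ) else (t.val : ℤ) - (2 * L + 1 : ℕ)), a, b, d]) =
      g (s • siteToE (d := 4) ![(if 2 * (t + Fin.ofNat (2 * L + 1) N).val < 2 * L + 1
          then ((t + Fin.ofNat (2 * L + 1) N).val : ℤ) else ((t + Fin.ofNat (2 * L + 1) N).val : ℤ) - (2 * L + 1 : ℕ)), a, b, d]) := by
  have ht := t.isLt
  have hval : (t + Fin.ofNat (2 * L + 1) N).val = (t.val + N % (2 * L + 1)) % (2 * L + 1) := by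
    rw [Fin.val_add, Fin.val_ofNat]
  -- the supports
  have key_g : ∀ p : EuclideanSpace ℝ (Fin 4), g p ≠ 0 → 0 < p 0 ∧ p 0 ≤ H := fun p hp =>
    hg (subset_tsupport _ (Function.mem_support.mpr hp))
  have key_gp : ∀ p : EuclideanSpace ℝ (Fin 4), gp p ≠ 0 → 0 < p 0 ∧ p 0 ≤ H := fun p hp =>
    hgp (subset_tsupport _ (Function.mem_support.mpr hp))
  rw [hdef]
  -- abbreviations for the two centred time coordinates
  set m₁ : ℤ := (if 2 * t.val < 2 * L + 1 then (t.val : ℤ) else (t.val : ℤ) - (2 * L + 1 : ℕ)) with hm₁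
  set m₂ : ℤ := (if 2 * (t + Fin.ofNat (2 * L + 1) N).val < 2 * L + 1 then ((t + Fin.ofNat (2 * L + 1) N).val : ℤ)
    else ((t + Fin.ofNat (2 * L + 1) N).val : ℤ) - (2 * L + 1 : ℕ)) with hm₂
  -- time coordinates of the three points
  have c1 : (s • siteToE (d := 4) ![m₁, a, b, d] + (s * (N : ℝ)) • EuclideanSpace.single (0 : Fin 4) (1 : ℝ)) 0 =
      s * ((m₁ + N : ℤ) : ℝ) := by
    simp only [PiLp.add_apply, PiLp.smul_apply, siteToE_apply, Matrix.cons_val_zero, smul_eq_mul, PiLp.single_apply,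
      if_true, mul_one]
    push_cast; ring
  have c0 : (s • siteToE (d := 4) ![m₁, a, b, d]) 0 = s * (m₁ : ℝ) := by
    simp only [PiLp.smul_apply, siteToE_apply, Matrix.cons_val_zero, smul_eq_mul]
  have c2 : (s • siteToE (d := 4) ![m₂, a, b, d]) 0 = s * (m₂ : ℝ) := by
    simp only [PiLp.smul_apply, siteToE_apply, Matrix.cons_val_zero, smul_eq_mul]
  have c3 : (s • siteToE (d := 4) ![m₂, a, b, d] - (s * (N : ℝ)) • EuclideanSpace.single (0 : Fin 4) (1 : ℝ)) 0 =
      s * ((m₂ - N : ℤ) : ℝ) := by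
    simp only [PiLp.sub_apply, PiLp.smul_apply, siteToE_apply, Matrix.cons_val_zero, smul_eq_mul, PiLp.single_apply,
      if_true, mul_one]
    push_cast; ring
  -- if the centred coordinates differ by `N`, the two points coincide
  have hpt : m₁ + N = m₂ → s • siteToE (d := 4) ![m₁, a, b, d] + (s * (N : ℝ)) • EuclideanSpace.single (0 : Fin 4) (1 : ℝ) =
      s • siteToE (d := 4) ![m₂, a, b, d] := by
    intro h
    rw [← h]
    ext i
    fin_cases i
    · simp [siteToE_apply]; ring
    · simp [siteToE_apply]
    · simp [siteToE_apply]
    · simp [siteToE_apply]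
  by_cases h0 : g (s • siteToE (d := 4) ![m₁, a, b, d] + (s * (N : ℝ)) • EuclideanSpace.single (0 : Fin 4) (1 : ℝ)) = 0 ∧
      g (s • siteToE (d := 4) ![m₂, a, b, d]) = 0
  · rw [h0.1, h0.2]
  have hmm : m₁ + N = m₂ := by
    rw [not_and_or] at h0
    rcases h0 with hA | hB
    · -- the translate is non-zero at the first point
      have hwin := key_g _ hA
      rw [c1] at hwin
      obtain ⟨h1, h2⟩ := int_window' hs hH _ hwin.1 hwin.2
      have hA' : gp (s • siteToE (d := 4) ![m₁, a, b, d]) ≠ 0 := by rwa [hdef]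
      have hwin' := key_gp _ hA'
      rw [c0] at hwin'
      obtain ⟨h3, _⟩ := int_window' hs hH _ hwin'.1 hwin'.2
      obtain ⟨hm₁v, h2t⟩ := cc_eq_val_of_one_le t (hm₁ ▸ h3)
      rw [← hm₁] at hm₁v
      have hN : N < 2 * L + 1 := by omega
      have hv : (t + Fin.ofNat (2 * L + 1) N).val = t.val + N := by
        rw [hval, Nat.mod_eq_of_lt hN, Nat.mod_eq_of_lt (by omega)]
      rw [hm₂, hv, if_pos (by omega), hm₁v]; push_cast; ring
    · -- `g` is non-zero at the second point
      have hwin := key_g _ hB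
      rw [c2] at hwin
      obtain ⟨h1, h2⟩ := int_window' hs hH _ hwin.1 hwin.2
      have hB' : gp (s • siteToE (d := 4) ![m₂, a, b, d] - (s * (N : ℝ)) • EuclideanSpace.single (0 : Fin 4) (1 : ℝ)) ≠ 0 := by
        rwa [hdef, sub_add_cancel]
      have hwin' := key_gp _ hB'
      rw [c3] at hwin'
      obtain ⟨h3, _⟩ := int_window' hs hH _ hwin'.1 hwin'.2
      obtain ⟨hm₂v, h2t⟩ := cc_eq_val_of_one_le (t + Fin.ofNat (2 * L + 1) N) (hm₂ ▸ h1)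
      rw [← hm₂] at hm₂v
      have hN : N < 2 * L + 1 := by omega
      rw [hval, Nat.mod_eq_of_lt hN] at hm₂v
      have htN : t.val + N < 2 * L + 1 := by
        by_contra hc
        rw [Nat.mod_eq_sub_mod (by omega), Nat.mod_eq_of_lt (by omega)] at hm₂v
        omega
      rw [Nat.mod_eq_of_lt htN] at hm₂v
      rw [hm₁, if_pos (by omega), hm₂v]; push_cast; ring
  rw [hpt hmm]

variable {G : Type} [Group G] {L : ℕ}

/-- Spatial steps do not change the time coordinate. [folklore] -/
theorem shift_time_eq_of_ne_last (x : FinTorusSite (2 * L + 1) (2 * L + 1) (2 * L + 1) (2 * L + 1)) {μ : Fin 4}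
    (hμ : μ ≠ Fin.last 3) : (x.shift μ).2.2.2 = x.2.2.2 := by
  obtain ⟨a, b, d, t⟩ := x
  fin_cases μ
  · rfl
  · rfl
  · rfl
  · exact absurd rfl hμ

/-- Plaquettes based at times `t` with `t + 1 ≤ L` and first direction spatial are functions of the positive half
(spatial links at times `≤ L`, temporal links at times `≤ L − 1`). [folklore] -/
theorem plaquette_congr_posHalf {U V : FinTorusSite (2 * L + 1) (2 * L + 1) (2 * L + 1) (2 * L + 1) × Fin 4 → G}
    (hUV : ∀ e : FinTorusSite (2 * L + 1) (2 * L + 1) (2 * L + 1) (2 * L + 1) × Fin 4,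
      (e.2 ≠ Fin.last 3 ∧ e.1.2.2.2.val ≤ L) ∨ (e.2 = Fin.last 3 ∧ e.1.2.2.2.val + 1 ≤ L) → U e = V e)
    (x : FinTorusSite (2 * L + 1) (2 * L + 1) (2 * L + 1) (2 * L + 1)) (hx : x.2.2.2.val + 1 ≤ L) {μ : Fin 4}
    (hμ : μ ≠ Fin.last 3) (ν : Fin 4) : finTorusPlaquette U x μ ν = finTorusPlaquette V x μ ν := by
  have hμt := shift_time_eq_of_ne_last x hμ
  have hνt := Summit.QuantumFields.YangMills.Theorems.ThermalDescentOddTorusRP.shift_time_le x ν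
  unfold finTorusPlaquette
  have e1 : U (x, μ) = V (x, μ) := hUV _ (Or.inl ⟨hμ, by simp; omega⟩)
  have e2 : U (x.shift μ, ν) = V (x.shift μ, ν) := by
    by_cases hν : ν = Fin.last 3
    · exact hUV _ (Or.inr ⟨hν, by simp [hμt]; omega⟩)
    · exact hUV _ (Or.inl ⟨hν, by simp [hμt]; omega⟩)
  have e3 : U (x.shift ν, μ) = V (x.shift ν, μ) := hUV _ (Or.inl ⟨hμ, by simp; omega⟩)
  have e4 : U (x, ν) = V (x, ν) := by
    by_cases hν : ν = Fin.last 3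
    · exact hUV _ (Or.inr ⟨hν, by simp; omega⟩)
    · exact hUV _ (Or.inl ⟨hν, by simp; omega⟩)
  rw [e1, e2, e3, e4]

/-- **Smeared plaquette fields of test functions with heights in `(0, H]`, `2H + 3s ≤ s(2L+1)`, live in the positive half**
of the hypercube `(2L+1)⁴` (base times `1 ≤ t ≤ L − 1`; plaquettes reach `t + 1 ≤ L`). [folklore] -/
theorem dependsOn_smeared {N : ℕ} (ρ : G →* Matrix (Fin N) (Fin N) ℂ) {s H : ℝ} (hs : 0 < s)
    (hH : 2 * H + 3 * s ≤ s * ((2 * L + 1 : ℕ) : ℝ)) {f : EuclideanSpace ℝ (Fin 4) → ℝ}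
    (hf : tsupport f ⊆ {y : EuclideanSpace ℝ (Fin 4) | 0 < y 0 ∧ y 0 ≤ H}) :
    DependsOn (fun U : FinTorusSite (2 * L + 1) (2 * L + 1) (2 * L + 1) (2 * L + 1) × Fin 4 → G =>
      ∑ x : FinTorusSite (2 * L + 1) (2 * L + 1) (2 * L + 1) (2 * L + 1),
        f (s • siteToE (d := 4)
          ![(if 2 * x.2.2.2.val < 2 * L + 1 then (x.2.2.2.val : ℤ) else (x.2.2.2.val : ℤ) - (2 * L + 1 : ℕ)),
            (if 2 * x.1.val < 2 * L + 1 then (x.1.val : ℤ) else (x.1.val : ℤ) - (2 * L + 1 : ℕ)),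
            (if 2 * x.2.1.val < 2 * L + 1 then (x.2.1.val : ℤ) else (x.2.1.val : ℤ) - (2 * L + 1 : ℕ)),
            (if 2 * x.2.2.1.val < 2 * L + 1 then (x.2.2.1.val : ℤ) else (x.2.2.1.val : ℤ) - (2 * L + 1 : ℕ))]) *
        ∑ q : {q : Fin 4 × Fin 4 // q.1 < q.2}, (ρ (finTorusPlaquette U x q.1.1 q.1.2)).trace.re)
      {e : FinTorusSite (2 * L + 1) (2 * L + 1) (2 * L + 1) (2 * L + 1) × Fin 4 |
        (e.2 ≠ Fin.last 3 ∧ e.1.2.2.2.val ≤ L) ∨ (e.2 = Fin.last 3 ∧ e.1.2.2.2.val + 1 ≤ L)} := by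
  intro U V hUV
  dsimp only
  refine Finset.sum_congr rfl fun x _ => ?_
  by_cases hne : f (s • siteToE (d := 4)
          ![(if 2 * x.2.2.2.val < 2 * L + 1 then (x.2.2.2.val : ℤ) else (x.2.2.2.val : ℤ) - (2 * L + 1 : ℕ)),
            (if 2 * x.1.val < 2 * L + 1 then (x.1.val : ℤ) else (x.1.val : ℤ) - (2 * L + 1 : ℕ)),
            (if 2 * x.2.1.val < 2 * L + 1 then (x.2.1.val : ℤ) else (x.2.1.val : ℤ) - (2 * L + 1 : ℕ)),
            (if 2 * x.2.2.1.val < 2 * L + 1 then (x.2.2.1.val : ℤ) else (x.2.2.1.val : ℤ) - (2 * L + 1 : ℕ))]) = 0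
  · rw [hne, zero_mul, zero_mul]
  · have hw := hf (subset_tsupport _ (Function.mem_support.mpr hne))
    simp only [Set.mem_setOf_eq, PiLp.smul_apply, siteToE_apply, Matrix.cons_val_zero, smul_eq_mul] at hw
    obtain ⟨h1, h2⟩ := int_window' hs hH _ hw.1 hw.2
    obtain ⟨hv, _⟩ := cc_eq_val_of_one_le x.2.2.2 h1
    rw [hv] at h2
    have ht : x.2.2.2.val + 1 ≤ L := by omega
    congr 1
    refine Finset.sum_congr rfl fun q _ => ?_
    rw [plaquette_congr_posHalf (fun e he => hUV e he) x ht (Fin.ne_last_of_lt q.2) q.1.2]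

end Window

/-! ## §5 Smeared fields of time translates are time-shifted smeared fields -/

section Smeared

open Literature.MathematicalPhysics.QuantumLattice

variable {G : Type} [Group G] {L : ℕ}

/-- **`B(g(· + sN e₀)) = B(g) ∘ τ_{−N}`**: the smeared plaquette field of the downward time translate `gp = g(· + sN e₀)` of an
admissible test function is the smeared field of `g` evaluated on the configuration shifted by `−N` lattice steps in time.
[folklore] -/
theorem smeared_translate {N₀ : ℕ} (ρ : G →* Matrix (Fin N₀) (Fin N₀) ℂ) {s H : ℝ} (hs : 0 < s)
    (hH : 2 * H + 3 * s ≤ s * ((2 * L + 1 : ℕ) : ℝ)) {g gp : EuclideanSpace ℝ (Fin 4) → ℝ} {N : ℕ}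
    (hg : tsupport g ⊆ {y : EuclideanSpace ℝ (Fin 4) | 0 < y 0 ∧ y 0 ≤ H})
    (hgp : tsupport gp ⊆ {y : EuclideanSpace ℝ (Fin 4) | 0 < y 0 ∧ y 0 ≤ H})
    (hdef : ∀ y, gp y = g (y + (s * (N : ℝ)) • EuclideanSpace.single (0 : Fin 4) (1 : ℝ)))
    (U : FinTorusSite (2 * L + 1) (2 * L + 1) (2 * L + 1) (2 * L + 1) × Fin 4 → G) :
    ∑ x : FinTorusSite (2 * L + 1) (2 * L + 1) (2 * L + 1) (2 * L + 1),
        gp (s • siteToE (d := 4)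
          ![(if 2 * x.2.2.2.val < 2 * L + 1 then (x.2.2.2.val : ℤ) else (x.2.2.2.val : ℤ) - (2 * L + 1 : ℕ)),
            (if 2 * x.1.val < 2 * L + 1 then (x.1.val : ℤ) else (x.1.val : ℤ) - (2 * L + 1 : ℕ)),
            (if 2 * x.2.1.val < 2 * L + 1 then (x.2.1.val : ℤ) else (x.2.1.val : ℤ) - (2 * L + 1 : ℕ)),
            (if 2 * x.2.2.1.val < 2 * L + 1 then (x.2.2.1.val : ℤ) else (x.2.2.1.val : ℤ) - (2 * L + 1 : ℕ))]) *
        ∑ q : {q : Fin 4 × Fin 4 // q.1 < q.2}, (ρ (finTorusPlaquette U x q.1.1 q.1.2)).trace.re =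
      ∑ x : FinTorusSite (2 * L + 1) (2 * L + 1) (2 * L + 1) (2 * L + 1),
        g (s • siteToE (d := 4)
          ![(if 2 * x.2.2.2.val < 2 * L + 1 then (x.2.2.2.val : ℤ) else (x.2.2.2.val : ℤ) - (2 * L + 1 : ℕ)),
            (if 2 * x.1.val < 2 * L + 1 then (x.1.val : ℤ) else (x.1.val : ℤ) - (2 * L + 1 : ℕ)),
            (if 2 * x.2.1.val < 2 * L + 1 then (x.2.1.val : ℤ) else (x.2.1.val : ℤ) - (2 * L + 1 : ℕ)),
            (if 2 * x.2.2.1.val < 2 * L + 1 then (x.2.2.1.val : ℤ) else (x.2.2.1.val : ℤ) - (2 * L + 1 : ℕ))]) *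
        ∑ q : {q : Fin 4 × Fin 4 // q.1 < q.2}, (ρ (finTorusPlaquette
          (fun e : FinTorusSite (2 * L + 1) (2 * L + 1) (2 * L + 1) (2 * L + 1) × Fin 4 =>
            U ((e.1.1, e.1.2.1, e.1.2.2.1, e.1.2.2.2 + -Fin.ofNat (2 * L + 1) N), e.2)) x q.1.1 q.1.2)).trace.re := by
  simp only [plaquette_timeShift]
  symm
  rw [← (Equiv.ofBijective _ (timeShift_site_bijective (S := 2 * L + 1) (Fin.ofNat (2 * L + 1) N))).sum_comp _]
  refine Finset.sum_congr rfl fun x _ => ?_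
  obtain ⟨a, b, d, t⟩ := x
  simp only [Equiv.ofBijective_apply, add_neg_cancel_right]
  rw [sample_translate hs hH hg hgp hdef t]

end Smeared

end Summit.QuantumFields.YangMills.Theorems.QrpTranslateLogConvex

end
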